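import Summits.QuantumFields.YangMills.Theorems.UV3UnitEnvelopeLinOfPartialIterates
import Summits.QuantumFields.YangMills.Theorems.UnitScaleTiltHistoryTailOfPackagePinnedLf
import Summits.QuantumFields.YangMills.Theorems.UnitScaleTiltHistoryTailOfPinnedHeightTailFreeRate
import Summits.QuantumFields.YangMills.Theorems.UnitScaleTiltHistoryTailOfPackageMassEnvelope
import HarnessLib

/-!
# R3 (cell `ym3-torus`, YM₃ on T³ — a ladder RUNG, NOT d = 4, NOT infinite volume, NOT a mass gap, NOT the Clay problem) —
# **THE 19936 CRUX `UnitScaleTilt.HistoryTailL` FROM THE (α) SOCKET, THE POLYMER FIELDS, THE MAIN-TERM ROW AND THE PURELY KINEMATIC ROW (a)′∀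
# «ALL PARTIAL ITERATED PUSH-FORWARDS OF HAAR UNDER THE FAMILY'S BLOCK AVERAGING ARE `≤ e^{c}·HAAR`» — BOTH ORGAN ROWS `hSii`, `hlf` REPLACED**

LEAD seat `ym-ust-19936-w1` g11 on crux `stmt-QuantumFields-19936` (`--supports`, helper; THEOREMS ONLY, 0 `def`, 0 `sorry`; CONDITIONAL face, closes nothing).

THE POINT.  The crux face of record tonight (✓p751413, `ym-ust-19936-w8` g11) reads `HistoryTailL ⟸ hpkg ∧ π ∧ hMain ∧ hSii ∧ hlf`, and after
`ym-ust-19936-w6` g7's FILE 3c the S organ row `hSii` follows from the mass envelope hJ «`m_K(r,·) ≤ e^{A₁}` a.e., K-uniform» (★★OWNER WORD 58's residual).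
K-21 ✓`UV3PinnedStepOrganOfPartialIterates` and K-22 ✓∕⧗`UV3UnitEnvelopeLinOfPartialIterates` showed that BOTH organ rows follow — up to a factor
`K + 1` on the U side — from the purely kinematic row (a)′∀ on the family's pinned block averaging `avT3 F K` (= `blockAvg ℰp` in range), via the
pub-ymgap N08 sufficiency theorem, the v1 floors notwithstanding.  THIS FILE absorbs the U-side factor through the probability door: the S-step text
(v3, any envelope `M`) is fed `M := (K+1)·e^{Cl}·Z_K`, and at the constrained heights `K + 1 ≤ (m+2)·β_{K−j}` (K-21 §1 ✓`succ_le_mul_beta`), so the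
pinned height tail comes out in the K-19′ letter `hP′` with `A + 1` in place of `A` (§1); composing with the S-face ✓p749772, the S-KNIT ✓p750864,
K-21 §4 and K-22 §4 (§2) and the LEAD socket ✓p748552 (§3):

  ★★★ `historyTailL_of_package_of_partialIterates_of_main (hpkg) (π) (hMain) (hPI) : UnitScaleTilt.HistoryTailL`.

So the 19936 crux displays, by kernel: the v1 (α) socket `hpkg : ∀ L, AlphaInputsT3AC L` (Bałaban's Theorems 1–3 for the AC tower, lane pub-balaban3d,
XXL), the polymer fields `π` (a parameter), the main-term membership row `hMain` (EX lane), and (a)′∀ — «for every family `F` one `c ≥ 0` such that at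
every run `K` every partial iterated push-forward `(Ū_{k−1}∘⋯∘Ū_j)_*dU_j`, `j < k ≤ K`, of product Haar under `avT3 F K` is `≤ e^{c}·dU_k`» — a
statement about `blockAvg ℰp` and Haar alone (no histories, weights, Z-terms, floors; №32-clean: a measure inequality).  (a)′∀ is OPEN for the tree's
averaging (one step is `Ū_*(dU) ≤ D·dV`, not `T1 = 1`; ★★OWNER WORD 64: off the 288-loop guard the composite is Haar EXACTLY, on it the activity is
`≤ K·h^{n(L)}` per bond — a tractable cluster expansion is the located route to it).

CONTENTS.
* §1 ★★ `pinnedHeightTail_of_lin'` — the door with linear slack: S-step (v3 text) + «`∃ Cl, ∀ K, ρ_K ≤ (K+1)·e^{Cl}·Z_K` a.e.» ⇒ `hP′` VERBATIM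
  (`A ↦ A + 1`, `C := (m+2)·e^{Cu+Cl}`); w8 g11's ✓`pinnedHeightTail_of'` with the factor carried and absorbed.
* §2 `unitEnvelopeLin_forall_of_partialIterates_of_main` (the `∀ L` U letter with slack from `hpkg`, `π`, `hMain`, (a)′∀ — K-22 §4 per family) and
  ★★★ `pinnedHeightTail_of_package_of_partialIterates_of_main (hpkg)(π)(hMain)(hPI) : ⟨hP′⟩`.
* §3 ★★★ `historyTailL_of_package_of_partialIterates_of_main (hpkg)(π)(hMain)(hPI) : UnitScaleTilt.HistoryTailL` — one `exact` through ✓p748552.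
* §4 (v1.1, ★★OWNER RULING №38 «GUARDED SOCKETS») the guarded twins `…'` with `hpkg : ∀ L, 1 < L → AlphaInputsT3AC L` — §2–§3's unguarded socket is
  refutable (`AlphaInputsT3AC 0` is false), so ★★★★ `historyTailL_of_package_of_partialIterates_of_main'` is THE letter to read.

HONEST SCOPE.  A CONDITIONAL face: `hpkg`, `hMain`, (a)′∀ are hypotheses, `π` a parameter; nothing of them, of `stub_pinnedStep`∕`stub_unitEnvelope` (the
registered rows, K-uniform letters), of `HistoryTailL` (19936) unconditionally, of the rung `YM3TorusSU2`, any continuum limit, d = 4, a mass gap or Clay is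
proved here.  YM₃ on T³ is rung R3 of the ladder, not the Clay problem.

References: T. Bałaban, Commun. Math. Phys. **102** (1985) 255–275 [Balaban1985UV3] ((2) p. 256, (5)–(7) pp. 256–257, (41) p. 266, (46)–(47) p. 267,
(67)–(71) p. 273, pp. 273–274); T. Bałaban, Commun. Math. Phys. **98** (1985) 17–51 [Balaban1985Averaging] ((15) p. 19).
-/

set_option autoImplicit false

noncomputable section

namespace Summit.QuantumFields.YangMills.Theorems.UnitScaleTiltHistoryTailOfPackagePartialIterates

open scoped BigOperators ENNReal
open MeasureTheory
open Literature.MathematicalPhysics.QuantumFieldTheory.Balaban1983to89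
open Literature.MathematicalPhysics.QuantumFieldTheory.Balaban1983to89.T3ContinuumYM3Torus
open Literature.MathematicalPhysics.QuantumFieldTheory.Balaban1983to89.T3UnitScaleTilt
open Literature.MathematicalPhysics.QuantumFieldTheory.Balaban1983to89.T3UnitLawDensityEML
open Literature.MathematicalPhysics.QuantumFieldTheory.Balaban1983to89.T3RestrictedUnitDensity
open Literature.MathematicalPhysics.QuantumFieldTheory.Balaban1983to89.T3CruxEstimates
open Literature.MathematicalPhysics.QuantumFieldTheory.Balaban1983to89.T3AlphaInputsAC
open Literature.MathematicalPhysics.QuantumFieldTheory.Balaban1983to89.Missing (partitionFn partitionFn_pos' isProbabilityMeasure_fieldMeasure)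
open Literature.MathematicalPhysics.QuantumFieldTheory.Balaban1985CMP102
open Literature.MathematicalPhysics.QuantumFieldTheory.Balaban1985CMP102.Setting
open Summit.QuantumFields.Balaban3D.Carriers
open Summit.QuantumFields.Balaban3D.Proofs.Primitives
open Summit.QuantumFields.Balaban3D.Proofs.StandardAC
open Summit.QuantumFields.Balaban3D.Proofs.InputsAC
open Summit.QuantumFields.YangMills.Theorems.UV3PinnedStepProfileReduction (measurableSet_pinEvent)
open Summit.QuantumFields.YangMills.Theorems.UV3PinnedStepV3FaceOfPackage (stub_pinnedStepV3_of_package_of_purePinTop_of_main)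
open Summit.QuantumFields.YangMills.Theorems.UnitScaleTiltHistoryTailOfPackageMassEnvelope (stub_pinnedStepV3_of_package_of_purePinTop_of_main')
open Summit.QuantumFields.YangMills.Theorems.UV3PinnedStepKnitOfPackage (hPinA_of_pinnedLF)
open Summit.QuantumFields.YangMills.Theorems.UV3PinnedStepOrganOfPartialIterates (succ_le_mul_beta hSii_forall_of_partialIterates)
open Summit.QuantumFields.YangMills.Theorems.UnitScaleTiltHistoryTailOfPinnedHeightTailFreeRate (historyTailL_of_pinnedHeightTail_freeRate)

/-! ## §1 The probability door with a slack linear in the run length on the envelope side -/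

/-- ★★ **THE PINNED HEIGHT TAIL `hP′` (K-19′'s hypothesis, VERBATIM) FROM THE S-STEP TEXT (v3) AND A UNIT ENVELOPE WITH LINEAR SLACK.**  As w8 g11's
✓`UnitScaleTiltHistoryTailOfPackagePinnedLf.pinnedHeightTail_of'` (the registered skeleton's §2 door), but the envelope row reads `ρ_K ≤ (K+1)·e^{Cl}·Z_K`
a.e.; per `(K, j, a)`: `Gibbs_K(E) = (∫ρ^E_K)∕Z_K ≤ (K+1)·e^{Cl+Cu}·β^A·e^{−cp²}` (S-step at `M := (K+1)·e^{Cl}·Z_K`), and at the constrained heights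
`K + 1 ≤ (m+2)·β_{K−j}` (K-21 ✓`succ_le_mul_beta`; `γ ≤ γ₁ ≤ 1`, `2 ≤ L`), so the letter holds with `C := (m+2)·e^{Cu+Cl}` and the power `A + 1`.
[cite: Balaban1985UV3, (2) p.256, (6)-(7) p.257] -/
theorem pinnedHeightTail_of_lin'
    (hStep : ∀ (L : ℕ), ∃ (b₁' p₁' : ℝ), ∀ (b₀ p₀ : ℝ), b₁' ≤ b₀ → p₁' ≤ p₀ → 0 < b₀ → 2 < p₀ → ∀ (m : ℕ), 0 < m →
      ∃ γ₁ : ℝ, 0 < γ₁ ∧ γ₁ ≤ 1 ∧ ∀ (F : T3Family) (γ : ℝ), F.L = L → 0 < γ → γ ≤ γ₁ →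
        ∃ (b p Cu c : ℝ) (A : ℕ), 0 < b ∧ 1 ≤ p ∧ 0 < c ∧
          ∀ (K j : ℕ), 1 ≤ j → j + 2 ≤ K → j + (K - 1) / m ≤ K → ∀ (a : Plaq (F.P K) j) (M : ℝ),
          (∀ᵐ V ∂(fieldMeasure (F.P K) K (Matrix.specialUnitaryGroup (Fin 2) ℂ)), emlDensity F γ K K V ≤ M) →
          ∀ᵐ V ∂(fieldMeasure (F.P K) K (Matrix.specialUnitaryGroup (Fin 2) ℂ)),
            resDensity F γ K
              ({U : GaugeField (F.P K) 0 (Matrix.specialUnitaryGroup (Fin 2) ℂ) |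
                  θBal F.L γ b₀ p₀ (K - j) ≤ GaugeGroup.dist1 (GaugeField.plaqHol
                    (Averaging.iter (fun i' => BlockAveraging.blockAvg (P := F.P K) (j := i') ℰp) j U) a)} ∩
                {U : GaugeField (F.P K) 0 (Matrix.specialUnitaryGroup (Fin 2) ℂ) | ∀ i, i < j →
                  PlaqSmall (θBal F.L γ b₀ p₀ (K - i))
                    (Averaging.iter (fun i' => BlockAveraging.blockAvg (P := F.P K) (j := i') ℰp) i U)})
              K V ≤
            M * Real.exp Cu *
              ((F.scheme ℰp γ).β (K - j) ^ A * Real.exp (-(c * B10.pFun b p (Real.sqrt (γ * ((F.L : ℝ)⁻¹) ^ (K - j))) ^ 2))))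
    (hLowLin : ∀ (L : ℕ), ∃ γ₁ : ℝ, 0 < γ₁ ∧ ∀ (F : T3Family) (γ : ℝ), F.L = L → 0 < γ → γ ≤ γ₁ →
      ∃ Cl : ℝ, ∀ K : ℕ, ∀ᵐ V ∂(fieldMeasure (F.P K) K (Matrix.specialUnitaryGroup (Fin 2) ℂ)),
        emlDensity F γ K K V ≤
          ((K : ℝ) + 1) * (Real.exp Cl * partitionFn (G := Matrix.specialUnitaryGroup (Fin 2) ℂ) (F.P K) ((F.scheme ℰp γ).β K))) :
    ∀ (L : ℕ), ∃ (b₁' p₁' : ℝ), ∀ (b₀ p₀ : ℝ), b₁' ≤ b₀ → p₁' ≤ p₀ → 0 < b₀ → 2 < p₀ → ∀ (m : ℕ), 0 < m →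
      ∃ γ₁ : ℝ, 0 < γ₁ ∧ γ₁ ≤ 1 ∧ ∀ (F : T3Family) (γ : ℝ), F.L = L → 0 < γ → γ ≤ γ₁ →
        ∃ (b p C c : ℝ) (A : ℕ), 0 < b ∧ 1 ≤ p ∧ 0 ≤ C ∧ 0 < c ∧
          ∀ (K j : ℕ), 1 ≤ j → j + 2 ≤ K → j + (K - 1) / m ≤ K → ∀ a : Plaq (F.P K) j,
          (gibbsK F ℰp γ K).real
              ({U : GaugeField (F.P K) 0 (Matrix.specialUnitaryGroup (Fin 2) ℂ) |
                  θBal F.L γ b₀ p₀ (K - j) ≤ GaugeGroup.dist1 (GaugeField.plaqHol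
                    (Averaging.iter (fun i' => BlockAveraging.blockAvg (P := F.P K) (j := i') ℰp) j U) a)} ∩
                {U : GaugeField (F.P K) 0 (Matrix.specialUnitaryGroup (Fin 2) ℂ) | ∀ i, i < j →
                  PlaqSmall (θBal F.L γ b₀ p₀ (K - i))
                    (Averaging.iter (fun i' => BlockAveraging.blockAvg (P := F.P K) (j := i') ℰp) i U)}) ≤
            C * (F.scheme ℰp γ).β (K - j) ^ A *
              Real.exp (-(c * B10.pFun b p (Real.sqrt (γ * ((F.L : ℝ)⁻¹) ^ (K - j))) ^ 2)) := by
  intro L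
  obtain ⟨b₁', p₁', HS⟩ := hStep L
  obtain ⟨γL, hγL, HL⟩ := hLowLin L
  refine ⟨b₁', p₁', fun b₀ p₀ hb hp hb₀ hp₀ m hm => ?_⟩
  obtain ⟨γ₁, hγ₁, hγ₁1, HF⟩ := HS b₀ p₀ hb hp hb₀ hp₀ m hm
  refine ⟨min γ₁ γL, lt_min hγ₁ hγL, (min_le_left _ _).trans hγ₁1, fun F γ hFL hγ hγle => ?_⟩
  obtain ⟨b, p, Cu, c, A, hb0, hp1, hc, hstep⟩ := HF F γ hFL hγ (hγle.trans (min_le_left _ _))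
  obtain ⟨Cl, hlow⟩ := HL F γ hFL hγ (hγle.trans (min_le_right _ _))
  have hγle1 : γ ≤ 1 := (hγle.trans (min_le_left _ _)).trans hγ₁1
  have hL2 : 2 ≤ F.L := F.hL.2
  refine ⟨b, p, ((m : ℝ) + 2) * Real.exp (Cu + Cl), c, A + 1, hb0, hp1, by positivity, hc, fun K j hj1 hjK hjm a => ?_⟩
  -- names
  set E : Set (GaugeField (F.P K) 0 (Matrix.specialUnitaryGroup (Fin 2) ℂ)) :=
    {U : GaugeField (F.P K) 0 (Matrix.specialUnitaryGroup (Fin 2) ℂ) |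
        θBal F.L γ b₀ p₀ (K - j) ≤ GaugeGroup.dist1 (GaugeField.plaqHol
          (Averaging.iter (fun i' => BlockAveraging.blockAvg (P := F.P K) (j := i') ℰp) j U) a)} ∩
      {U : GaugeField (F.P K) 0 (Matrix.specialUnitaryGroup (Fin 2) ℂ) | ∀ i, i < j →
        PlaqSmall (θBal F.L γ b₀ p₀ (K - i))
          (Averaging.iter (fun i' => BlockAveraging.blockAvg (P := F.P K) (j := i') ℰp) i U)} with hEdef
  set R : ℝ := Real.exp (-(c * B10.pFun b p (Real.sqrt (γ * ((F.L : ℝ)⁻¹) ^ (K - j))) ^ 2)) with hRdef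
  set w : ℝ := (F.scheme ℰp γ).β (K - j) ^ A * R with hwdef
  set Z : ℝ := partitionFn (G := Matrix.specialUnitaryGroup (Fin 2) ℂ) (F.P K) ((F.scheme ℰp γ).β K) with hZdef
  have hγ0 : 0 ≤ γ := hγ.le
  have hβ0 : 0 ≤ (F.scheme ℰp γ).β (K - j) := F.scheme_β_nonneg ℰp hγ0 (K - j)
  have hR0 : 0 ≤ R := by rw [hRdef]; exact (Real.exp_pos _).le
  have hw : 0 ≤ w := mul_nonneg (pow_nonneg hβ0 A) hR0
  have hZ : 0 < Z := partitionFn_pos' _ (F.scheme_β_nonneg ℰp hγ0 K)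
  have hK1 : (0 : ℝ) ≤ (K : ℝ) + 1 := by positivity
  -- the constrained heights absorb `K + 1`
  have hKβ : (K : ℝ) + 1 ≤ ((m : ℝ) + 2) * (F.scheme ℰp γ).β (K - j) := succ_le_mul_beta hL2 hm hjK hjm hγ hγle1
  -- measurability of the event
  have hE : MeasurableSet E := measurableSet_pinEvent F γ K b₀ p₀ (by omega) a
  -- (2)/(6): the Gibbs probability of `E` is the integral of the final restricted density over `Z_K`
  have hrepr : (gibbsK F ℰp γ K).real E =
      (∫ V, resDensity F γ K E K V ∂fieldMeasure (F.P K) K (Matrix.specialUnitaryGroup (Fin 2) ℂ)) / Z := by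
    have e := real_gibbsK_iter_mem F hγ0 K 0 (Nat.zero_le _) hE
    have e' : (gibbsK F ℰp γ K).real E =
        (∫ V in E, emlDensity F γ K 0 V ∂fieldMeasure (F.P K) 0 (Matrix.specialUnitaryGroup (Fin 2) ℂ)) / Z := e
    rw [e', ← integral_indicator hE]
    congr 1
    have h1 := integral_resDensity_mul F K hE hγ0 (k := K) (Nat.le_add_left K F.m) (fun _ => (1 : ℝ)) measurable_const
      ⟨1, fun _ => by simp⟩
    simp only [mul_one] at h1
    rw [h1]
    rfl
  -- a.e.: ρ^E_K ≤ ((K+1)·e^{Cl}·Z_K)·e^{Cu}·w — S-step fed with the slack envelope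
  have hae : ∀ᵐ V ∂(fieldMeasure (F.P K) K (Matrix.specialUnitaryGroup (Fin 2) ℂ)),
      resDensity F γ K E K V ≤ (((K : ℝ) + 1) * (Real.exp Cl * Z)) * Real.exp Cu * w :=
    hstep K j hj1 hjK hjm a (((K : ℝ) + 1) * (Real.exp Cl * Z)) (hlow K)
  -- integrate over the last fibre (product Haar is a probability measure)
  haveI : IsProbabilityMeasure (fieldMeasure (F.P K) K (Matrix.specialUnitaryGroup (Fin 2) ℂ)) :=
    isProbabilityMeasure_fieldMeasure _ _
  have hnum : (∫ V, resDensity F γ K E K V ∂fieldMeasure (F.P K) K (Matrix.specialUnitaryGroup (Fin 2) ℂ)) ≤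
      (((K : ℝ) + 1) * (Real.exp Cl * Z)) * Real.exp Cu * w := by
    have hmono := integral_mono_ae (integrable_resDensity F K hE hγ0 (k := K) (Nat.le_add_left K F.m))
      (integrable_const ((((K : ℝ) + 1) * (Real.exp Cl * Z)) * Real.exp Cu * w)) hae
    simpa [integral_const, smul_eq_mul] using hmono
  -- assemble
  have hX0 : 0 ≤ Real.exp Cl * Z * Real.exp Cu * w := by positivity
  rw [hrepr, div_le_iff₀ hZ]
  calc (∫ V, resDensity F γ K E K V ∂fieldMeasure (F.P K) K (Matrix.specialUnitaryGroup (Fin 2) ℂ))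
      ≤ (((K : ℝ) + 1) * (Real.exp Cl * Z)) * Real.exp Cu * w := hnum
    _ = ((K : ℝ) + 1) * (Real.exp Cl * Z * Real.exp Cu * w) := by ring
    _ ≤ ((m : ℝ) + 2) * (F.scheme ℰp γ).β (K - j) * (Real.exp Cl * Z * Real.exp Cu * w) :=
        mul_le_mul_of_nonneg_right hKβ hX0
    _ = ((m : ℝ) + 2) * Real.exp (Cu + Cl) * (F.scheme ℰp γ).β (K - j) ^ (A + 1) * R * Z := by
        rw [Real.exp_add, hwdef, pow_succ]; ring

/-! ## §2 The letters from the socket, the polymer fields, the main-term row and (a)′∀ -/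

/-- **THE `∀ L` UNIT-ENVELOPE LETTER WITH LINEAR SLACK FROM `hpkg`, `π`, `hMain`, (a)′∀** — K-22 ✓`AlphaInputsT3AC.Of.unitEnvelopeLin_of_partialIterates_of_main`
family by family at the package's record for the block size (threshold `γ₁ := (min γ₀ 1)²`), as w8 g11's ✓`stub_unitEnvelope_of_package_of_lf_ae_of_main`.
[cite: Balaban1985UV3, Thm 1 (5)–(6) pp.256–257, (41) p.266, (46)–(47) p.267] -/
theorem unitEnvelopeLin_forall_of_partialIterates_of_main (π : ∀ F : T3Family, AlphaInputsT3AC.PolymerT3 F)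
    (hpkg : ∀ L : ℕ, AlphaInputsT3AC L)
    (hMain : ∀ (F : T3Family) (𝔠 : AlphaConsts F.L (suGroupModel 2).N) (h : AlphaInputsT3AC.Of F 𝔠) (γ : ℝ) (hγ : 0 < γ)
      (hγ1 : γ ≤ (min 𝔠.gamma0 1) ^ 2), ∃ Cm : ℝ, ∀ (K : ℕ) (W : GaugeField (F.P K) K (Matrix.specialUnitaryGroup (Fin 2) ℂ)),
        PlaqSmall (θBal F.L γ 𝔠.b₀ 𝔠.p₀ 0) W →
          (h.dataT3 γ hγ hγ1 (π F)).mainT K K ((h.dataT3 γ hγ hγ1 (π F)).triv K K) W ≤ Cm)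
    (hPI : ∀ F : T3Family, ∃ c : ℝ, 0 ≤ c ∧
      ∀ (K : ℕ) (ι : ∀ j k : ℕ, Measure (GaugeField (F.P K) k (Matrix.specialUnitaryGroup (Fin 2) ℂ))),
      (∀ j, ι j j = fieldMeasure (F.P K) j (Matrix.specialUnitaryGroup (Fin 2) ℂ)) →
      (∀ j k, j ≤ k → ι j (k + 1) = (ι j k).map (avT3 F K k).avg) →
      ∀ j k, j < k → k ≤ K → ι j k ≤ ENNReal.ofReal (Real.exp c) • fieldMeasure (F.P K) k (Matrix.specialUnitaryGroup (Fin 2) ℂ)) :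
    ∀ (L : ℕ), ∃ γ₁ : ℝ, 0 < γ₁ ∧ ∀ (F : T3Family) (γ : ℝ), F.L = L → 0 < γ → γ ≤ γ₁ →
      ∃ Cl : ℝ, ∀ K : ℕ, ∀ᵐ V ∂(fieldMeasure (F.P K) K (Matrix.specialUnitaryGroup (Fin 2) ℂ)),
        emlDensity F γ K K V ≤
          ((K : ℝ) + 1) * (Real.exp Cl * partitionFn (G := Matrix.specialUnitaryGroup (Fin 2) ℂ) (F.P K) ((F.scheme ℰp γ).β K)) := by
  intro L
  obtain ⟨𝔠, h𝔠⟩ := hpkg L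
  refine ⟨(min 𝔠.gamma0 1) ^ 2, pow_pos (lt_min 𝔠.gamma0_pos one_pos) 2, fun F γ hFL hγ hγle => ?_⟩
  subst hFL
  exact (h𝔠 F rfl).unitEnvelopeLin_of_partialIterates_of_main γ hγ hγle (π F) (hPI F) (hMain F 𝔠 (h𝔠 F rfl) γ hγ hγle)

/-- ★★★ **THE PINNED HEIGHT TAIL `hP′` (the LEAD's K-19′ socket hypothesis, VERBATIM) FROM `hpkg`, `π`, `hMain` AND (a)′∀.**  S side: the S-face ✓p749772
`stub_pinnedStepV3_of_package_of_purePinTop_of_main (hpkg)(π)(hMain)(hPinA)` with `hPinA` from the S-KNIT ✓p750864 `hPinA_of_pinnedLF (π)(hSii)` and `hSii`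
from K-21 ✓`hSii_forall_of_partialIterates (hPI)`; U side: `unitEnvelopeLin_forall_of_partialIterates_of_main`; door §1.
[cite: Balaban1985UV3, Thm 1 (5) p.256, (2) p.256, (41) p.266, (47) p.267, (67)–(71) p.273, pp.273–274; Balaban1985Averaging, (15) p.19] -/
theorem pinnedHeightTail_of_package_of_partialIterates_of_main
    (hpkg : ∀ L : ℕ, AlphaInputsT3AC L)
    (π : ∀ F : T3Family, AlphaInputsT3AC.PolymerT3 F)
    (hMain : ∀ (F : T3Family) (𝔠 : AlphaConsts F.L (suGroupModel 2).N) (h : AlphaInputsT3AC.Of F 𝔠) (γ : ℝ) (hγ : 0 < γ)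
      (hγ1 : γ ≤ (min 𝔠.gamma0 1) ^ 2), ∃ Cm : ℝ, ∀ (K : ℕ) (W : GaugeField (F.P K) K (Matrix.specialUnitaryGroup (Fin 2) ℂ)),
        PlaqSmall (θBal F.L γ 𝔠.b₀ 𝔠.p₀ 0) W →
          (h.dataT3 γ hγ hγ1 (π F)).mainT K K ((h.dataT3 γ hγ hγ1 (π F)).triv K K) W ≤ Cm)
    (hPI : ∀ F : T3Family, ∃ c : ℝ, 0 ≤ c ∧
      ∀ (K : ℕ) (ι : ∀ j k : ℕ, Measure (GaugeField (F.P K) k (Matrix.specialUnitaryGroup (Fin 2) ℂ))),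
      (∀ j, ι j j = fieldMeasure (F.P K) j (Matrix.specialUnitaryGroup (Fin 2) ℂ)) →
      (∀ j k, j ≤ k → ι j (k + 1) = (ι j k).map (avT3 F K k).avg) →
      ∀ j k, j < k → k ≤ K → ι j k ≤ ENNReal.ofReal (Real.exp c) • fieldMeasure (F.P K) k (Matrix.specialUnitaryGroup (Fin 2) ℂ)) :
    ∀ (L : ℕ), ∃ (b₁' p₁' : ℝ), ∀ (b₀ p₀ : ℝ), b₁' ≤ b₀ → p₁' ≤ p₀ → 0 < b₀ → 2 < p₀ → ∀ (m : ℕ), 0 < m →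
      ∃ γ₁ : ℝ, 0 < γ₁ ∧ γ₁ ≤ 1 ∧ ∀ (F : T3Family) (γ : ℝ), F.L = L → 0 < γ → γ ≤ γ₁ →
        ∃ (b p C c : ℝ) (A : ℕ), 0 < b ∧ 1 ≤ p ∧ 0 ≤ C ∧ 0 < c ∧
          ∀ (K j : ℕ), 1 ≤ j → j + 2 ≤ K → j + (K - 1) / m ≤ K → ∀ a : Plaq (F.P K) j,
          (gibbsK F ℰp γ K).real
              ({U : GaugeField (F.P K) 0 (Matrix.specialUnitaryGroup (Fin 2) ℂ) |
                  θBal F.L γ b₀ p₀ (K - j) ≤ GaugeGroup.dist1 (GaugeField.plaqHol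
                    (Averaging.iter (fun i' => BlockAveraging.blockAvg (P := F.P K) (j := i') ℰp) j U) a)} ∩
                {U : GaugeField (F.P K) 0 (Matrix.specialUnitaryGroup (Fin 2) ℂ) | ∀ i, i < j →
                  PlaqSmall (θBal F.L γ b₀ p₀ (K - i))
                    (Averaging.iter (fun i' => BlockAveraging.blockAvg (P := F.P K) (j := i') ℰp) i U)}) ≤
            C * (F.scheme ℰp γ).β (K - j) ^ A *
              Real.exp (-(c * B10.pFun b p (Real.sqrt (γ * ((F.L : ℝ)⁻¹) ^ (K - j))) ^ 2)) :=
  pinnedHeightTail_of_lin'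
    (stub_pinnedStepV3_of_package_of_purePinTop_of_main hpkg π hMain
      (hPinA_of_pinnedLF π (hSii_forall_of_partialIterates hPI)))
    (unitEnvelopeLin_forall_of_partialIterates_of_main π hpkg hMain hPI)

/-! ## §3 The crux by name -/

/-- ★★★ **`UnitScaleTilt.HistoryTailL` (stmt-QuantumFields-19936) FROM THE v1 (α) SOCKET, THE POLYMER FIELDS, THE MAIN-TERM ROW AND (a)′∀** — §2 through the
LEAD socket ✓p748552 `historyTailL_of_pinnedHeightTail_freeRate`, one `exact`.  CONDITIONAL: closes nothing; the displayed rows are `hpkg` (XXL, lane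
pub-balaban3d), `hMain` (EX lane), (a)′∀ (N08 loop part, OPEN for `blockAvg ℰp`); `π` is a parameter.  R3 = YM₃ on T³, a rung — NOT d = 4, NOT infinite volume,
NOT a mass gap, NOT Clay. [cite: Balaban1985UV3, Thm 1 (5) p.256, (2) p.256, (41) p.266, (47) p.267, (67)–(71) p.273; Balaban1985Averaging, (15) p.19] -/
theorem historyTailL_of_package_of_partialIterates_of_main
    (hpkg : ∀ L : ℕ, AlphaInputsT3AC L)
    (π : ∀ F : T3Family, AlphaInputsT3AC.PolymerT3 F)
    (hMain : ∀ (F : T3Family) (𝔠 : AlphaConsts F.L (suGroupModel 2).N) (h : AlphaInputsT3AC.Of F 𝔠) (γ : ℝ) (hγ : 0 < γ)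
      (hγ1 : γ ≤ (min 𝔠.gamma0 1) ^ 2), ∃ Cm : ℝ, ∀ (K : ℕ) (W : GaugeField (F.P K) K (Matrix.specialUnitaryGroup (Fin 2) ℂ)),
        PlaqSmall (θBal F.L γ 𝔠.b₀ 𝔠.p₀ 0) W →
          (h.dataT3 γ hγ hγ1 (π F)).mainT K K ((h.dataT3 γ hγ hγ1 (π F)).triv K K) W ≤ Cm)
    (hPI : ∀ F : T3Family, ∃ c : ℝ, 0 ≤ c ∧
      ∀ (K : ℕ) (ι : ∀ j k : ℕ, Measure (GaugeField (F.P K) k (Matrix.specialUnitaryGroup (Fin 2) ℂ))),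
      (∀ j, ι j j = fieldMeasure (F.P K) j (Matrix.specialUnitaryGroup (Fin 2) ℂ)) →
      (∀ j k, j ≤ k → ι j (k + 1) = (ι j k).map (avT3 F K k).avg) →
      ∀ j k, j < k → k ≤ K → ι j k ≤ ENNReal.ofReal (Real.exp c) • fieldMeasure (F.P K) k (Matrix.specialUnitaryGroup (Fin 2) ℂ)) :
    Summit.QuantumFields.YangMills.Theses.UnitScaleTilt.HistoryTailL :=
  historyTailL_of_pinnedHeightTail_freeRate (pinnedHeightTail_of_package_of_partialIterates_of_main hpkg π hMain hPI)


/-! ## §4 Guarded socket twins (★★OWNER RULING №38 «GUARDED SOCKETS»): `hpkg : ∀ L, 1 < L → AlphaInputsT3AC L`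

`AlphaInputsT3AC 0` and `AlphaInputsT3AC 1` are false (`AlphaConsts.one_lt_L`), so the unguarded socket of §2–§3 (inherited from the v1 faces) is refutable and
those implications are vacuous as typed.  The twins below take the GUARDED socket; at `L ≤ 1` no three-torus family exists (`T3Family.hL`), so the `∀ L`
letters hold there trivially.  The mathematics of §1–§3 is unchanged. -/

/-- **THE `∀ L` UNIT-ENVELOPE LETTER WITH LINEAR SLACK FROM THE GUARDED SOCKET, `π`, `hMain`, (a)′∀** — guarded twin of
`unitEnvelopeLin_forall_of_partialIterates_of_main` (`L ≤ 1` vacuous: no family has that block size). [cite: Balaban1985UV3, Thm 1 (5)–(6) pp.256–257, (41) p.266, (46)–(47) p.267] -/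
theorem unitEnvelopeLin_forall_of_partialIterates_of_main' (π : ∀ F : T3Family, AlphaInputsT3AC.PolymerT3 F)
    (hpkg : ∀ L : ℕ, 1 < L → AlphaInputsT3AC L)
    (hMain : ∀ (F : T3Family) (𝔠 : AlphaConsts F.L (suGroupModel 2).N) (h : AlphaInputsT3AC.Of F 𝔠) (γ : ℝ) (hγ : 0 < γ)
      (hγ1 : γ ≤ (min 𝔠.gamma0 1) ^ 2), ∃ Cm : ℝ, ∀ (K : ℕ) (W : GaugeField (F.P K) K (Matrix.specialUnitaryGroup (Fin 2) ℂ)),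
        PlaqSmall (θBal F.L γ 𝔠.b₀ 𝔠.p₀ 0) W →
          (h.dataT3 γ hγ hγ1 (π F)).mainT K K ((h.dataT3 γ hγ hγ1 (π F)).triv K K) W ≤ Cm)
    (hPI : ∀ F : T3Family, ∃ c : ℝ, 0 ≤ c ∧
      ∀ (K : ℕ) (ι : ∀ j k : ℕ, Measure (GaugeField (F.P K) k (Matrix.specialUnitaryGroup (Fin 2) ℂ))),
      (∀ j, ι j j = fieldMeasure (F.P K) j (Matrix.specialUnitaryGroup (Fin 2) ℂ)) →
      (∀ j k, j ≤ k → ι j (k + 1) = (ι j k).map (avT3 F K k).avg) →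
      ∀ j k, j < k → k ≤ K → ι j k ≤ ENNReal.ofReal (Real.exp c) • fieldMeasure (F.P K) k (Matrix.specialUnitaryGroup (Fin 2) ℂ)) :
    ∀ (L : ℕ), ∃ γ₁ : ℝ, 0 < γ₁ ∧ ∀ (F : T3Family) (γ : ℝ), F.L = L → 0 < γ → γ ≤ γ₁ →
      ∃ Cl : ℝ, ∀ K : ℕ, ∀ᵐ V ∂(fieldMeasure (F.P K) K (Matrix.specialUnitaryGroup (Fin 2) ℂ)),
        emlDensity F γ K K V ≤
          ((K : ℝ) + 1) * (Real.exp Cl * partitionFn (G := Matrix.specialUnitaryGroup (Fin 2) ℂ) (F.P K) ((F.scheme ℰp γ).β K)) := by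
  intro L
  by_cases hL : 1 < L
  · obtain ⟨𝔠, h𝔠⟩ := hpkg L hL
    refine ⟨(min 𝔠.gamma0 1) ^ 2, pow_pos (lt_min 𝔠.gamma0_pos one_pos) 2, fun F γ hFL hγ hγle => ?_⟩
    subst hFL
    exact (h𝔠 F rfl).unitEnvelopeLin_of_partialIterates_of_main γ hγ hγle (π F) (hPI F) (hMain F 𝔠 (h𝔠 F rfl) γ hγ hγle)
  · -- no three-torus family has block size `L ≤ 1`
    exact ⟨1, one_pos, fun F γ hFL _ _ => absurd (hFL ▸ F.hL.2) hL⟩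

/-- ★★★ **THE PINNED HEIGHT TAIL `hP′` FROM THE GUARDED SOCKET, `π`, `hMain` AND (a)′∀** — guarded twin of `pinnedHeightTail_of_package_of_partialIterates_of_main`:
S side through w8 g11's guarded S-face twin ✓`UnitScaleTiltHistoryTailOfPackageMassEnvelope.stub_pinnedStepV3_of_package_of_purePinTop_of_main'` (∘ ✓`hPinA_of_pinnedLF`
∘ K-21 ✓`hSii_forall_of_partialIterates`), U side `unitEnvelopeLin_forall_of_partialIterates_of_main'`, door §1.
[cite: Balaban1985UV3, Thm 1 (5) p.256, (2) p.256, (41) p.266, (47) p.267, (67)–(71) p.273, pp.273–274; Balaban1985Averaging, (15) p.19] -/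
theorem pinnedHeightTail_of_package_of_partialIterates_of_main'
    (hpkg : ∀ L : ℕ, 1 < L → AlphaInputsT3AC L)
    (π : ∀ F : T3Family, AlphaInputsT3AC.PolymerT3 F)
    (hMain : ∀ (F : T3Family) (𝔠 : AlphaConsts F.L (suGroupModel 2).N) (h : AlphaInputsT3AC.Of F 𝔠) (γ : ℝ) (hγ : 0 < γ)
      (hγ1 : γ ≤ (min 𝔠.gamma0 1) ^ 2), ∃ Cm : ℝ, ∀ (K : ℕ) (W : GaugeField (F.P K) K (Matrix.specialUnitaryGroup (Fin 2) ℂ)),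
        PlaqSmall (θBal F.L γ 𝔠.b₀ 𝔠.p₀ 0) W →
          (h.dataT3 γ hγ hγ1 (π F)).mainT K K ((h.dataT3 γ hγ hγ1 (π F)).triv K K) W ≤ Cm)
    (hPI : ∀ F : T3Family, ∃ c : ℝ, 0 ≤ c ∧
      ∀ (K : ℕ) (ι : ∀ j k : ℕ, Measure (GaugeField (F.P K) k (Matrix.specialUnitaryGroup (Fin 2) ℂ))),
      (∀ j, ι j j = fieldMeasure (F.P K) j (Matrix.specialUnitaryGroup (Fin 2) ℂ)) →
      (∀ j k, j ≤ k → ι j (k + 1) = (ι j k).map (avT3 F K k).avg) →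
      ∀ j k, j < k → k ≤ K → ι j k ≤ ENNReal.ofReal (Real.exp c) • fieldMeasure (F.P K) k (Matrix.specialUnitaryGroup (Fin 2) ℂ)) :
    ∀ (L : ℕ), ∃ (b₁' p₁' : ℝ), ∀ (b₀ p₀ : ℝ), b₁' ≤ b₀ → p₁' ≤ p₀ → 0 < b₀ → 2 < p₀ → ∀ (m : ℕ), 0 < m →
      ∃ γ₁ : ℝ, 0 < γ₁ ∧ γ₁ ≤ 1 ∧ ∀ (F : T3Family) (γ : ℝ), F.L = L → 0 < γ → γ ≤ γ₁ →
        ∃ (b p C c : ℝ) (A : ℕ), 0 < b ∧ 1 ≤ p ∧ 0 ≤ C ∧ 0 < c ∧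
          ∀ (K j : ℕ), 1 ≤ j → j + 2 ≤ K → j + (K - 1) / m ≤ K → ∀ a : Plaq (F.P K) j,
          (gibbsK F ℰp γ K).real
              ({U : GaugeField (F.P K) 0 (Matrix.specialUnitaryGroup (Fin 2) ℂ) |
                  θBal F.L γ b₀ p₀ (K - j) ≤ GaugeGroup.dist1 (GaugeField.plaqHol
                    (Averaging.iter (fun i' => BlockAveraging.blockAvg (P := F.P K) (j := i') ℰp) j U) a)} ∩
                {U : GaugeField (F.P K) 0 (Matrix.specialUnitaryGroup (Fin 2) ℂ) | ∀ i, i < j →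
                  PlaqSmall (θBal F.L γ b₀ p₀ (K - i))
                    (Averaging.iter (fun i' => BlockAveraging.blockAvg (P := F.P K) (j := i') ℰp) i U)}) ≤
            C * (F.scheme ℰp γ).β (K - j) ^ A *
              Real.exp (-(c * B10.pFun b p (Real.sqrt (γ * ((F.L : ℝ)⁻¹) ^ (K - j))) ^ 2)) :=
  pinnedHeightTail_of_lin'
    (stub_pinnedStepV3_of_package_of_purePinTop_of_main' hpkg π hMain
      (hPinA_of_pinnedLF π (hSii_forall_of_partialIterates hPI)))
    (unitEnvelopeLin_forall_of_partialIterates_of_main' π hpkg hMain hPI)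

/-- ★★★★ **`UnitScaleTilt.HistoryTailL` (stmt-QuantumFields-19936) FROM THE GUARDED v1 (α) SOCKET, THE POLYMER FIELDS, THE MAIN-TERM ROW AND (a)′∀** — guarded twin
of `historyTailL_of_package_of_partialIterates_of_main` (★★OWNER RULING №38: the socket reads `∀ L, 1 < L → AlphaInputsT3AC L`, inhabitable), one `exact` through the
LEAD socket ✓p748552.  Beside the face of record ✓`UnitScaleTiltHistoryTailOfPackageMassEnvelope.historyTailL_of_package_of_massEnvelope_of_main (hpkg)(π)(hMain)(hJ)(hTriv)`
this letter needs NO trivial-history row `hTriv` and replaces the mass envelope hJ by the kinematic (a)′∀ (iterated push-forwards of Haar alone).  CONDITIONAL: closes nothing;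
`hpkg` (XXL, lane pub-balaban3d), `hMain` (EX lane), (a)′∀ (N08 loop part, OPEN for `blockAvg ℰp`) are displayed, `π` is a parameter.  R3 = YM₃ on T³, a rung — NOT d = 4,
NOT infinite volume, NOT a mass gap, NOT Clay. [cite: Balaban1985UV3, Thm 1 (5) p.256, (2) p.256, (41) p.266, (47) p.267, (67)–(71) p.273; Balaban1985Averaging, (15) p.19] -/
theorem historyTailL_of_package_of_partialIterates_of_main'
    (hpkg : ∀ L : ℕ, 1 < L → AlphaInputsT3AC L)
    (π : ∀ F : T3Family, AlphaInputsT3AC.PolymerT3 F)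
    (hMain : ∀ (F : T3Family) (𝔠 : AlphaConsts F.L (suGroupModel 2).N) (h : AlphaInputsT3AC.Of F 𝔠) (γ : ℝ) (hγ : 0 < γ)
      (hγ1 : γ ≤ (min 𝔠.gamma0 1) ^ 2), ∃ Cm : ℝ, ∀ (K : ℕ) (W : GaugeField (F.P K) K (Matrix.specialUnitaryGroup (Fin 2) ℂ)),
        PlaqSmall (θBal F.L γ 𝔠.b₀ 𝔠.p₀ 0) W →
          (h.dataT3 γ hγ hγ1 (π F)).mainT K K ((h.dataT3 γ hγ hγ1 (π F)).triv K K) W ≤ Cm)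
    (hPI : ∀ F : T3Family, ∃ c : ℝ, 0 ≤ c ∧
      ∀ (K : ℕ) (ι : ∀ j k : ℕ, Measure (GaugeField (F.P K) k (Matrix.specialUnitaryGroup (Fin 2) ℂ))),
      (∀ j, ι j j = fieldMeasure (F.P K) j (Matrix.specialUnitaryGroup (Fin 2) ℂ)) →
      (∀ j k, j ≤ k → ι j (k + 1) = (ι j k).map (avT3 F K k).avg) →
      ∀ j k, j < k → k ≤ K → ι j k ≤ ENNReal.ofReal (Real.exp c) • fieldMeasure (F.P K) k (Matrix.specialUnitaryGroup (Fin 2) ℂ)) :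
    Summit.QuantumFields.YangMills.Theses.UnitScaleTilt.HistoryTailL :=
  historyTailL_of_pinnedHeightTail_freeRate (pinnedHeightTail_of_package_of_partialIterates_of_main' hpkg π hMain hPI)

end Summit.QuantumFields.YangMills.Theorems.UnitScaleTiltHistoryTailOfPackagePartialIterates

end
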